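import Summits.QuantumFields.YangMills.Theorems.BalabanUVNodesN07Eq157ActionInChartCoordinates
import Summits.QuantumFields.YangMills.Theorems.BalabanUVNodesN07SocketOfChartedCriticality
import Summits.QuantumFields.YangMills.Theorems.BalabanUVNodesK0Stub1FlatScaledFrobeniusDictionary
import Summits.QuantumFields.YangMills.Theorems.BalabanUVNodesK0Stub1V0Reality
import Summits.QuantumFields.YangMills.Theorems.BalabanUVNodesK0Stub1FlatChartQlinLetters
import Summits.QuantumFields.YangMills.Theorems.BalabanUVNodesK0FlatCubeOpsTextP
import Summits.QuantumFields.YangMills.Theorems.BalabanUVNodesN07ChartLogReality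
import Literature.MathematicalPhysics.QuantumFieldTheory.Balaban1983to89.MatrixNorms
import HarnessLib

/-!
# K0⁷ STUB 1 (`stub_prop8StepCoP13`), sub-target S4b «the (δ∕δA′)V pieces at objects» — **[15] (157) AT INSTANCE (S) IN S1's CURRENCY, AND THE ♭ (127)
# FROM STATIONARITY**: for Hermitian-traceless `A′`, `Dd` and the letters DISPLAYED by this seat's D″ (`…SectFWSlotAtRecordFlatScaledExists`: `τ = ntr`,
# `B = Σ_t τ`, the scaled multiplier `M♭`, the ♭ right inverse `H♭` by their kernel formulas), with `⇑X = iη•A′`, `⇑W = iη•H♭Dd` in S1's tangent carrier: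
# **`𝔄(expChart 1 (X − W)) = ½⟪X, Δ_1X⟫ + Re(½B(Dd, η⁴•M♭Dd) − B(Qlin♭A′, η⁴•M♭Dd) + V₀[shiftEquiv, 1](A′ − H♭Dd))`** — the functional inside `Re` is D″'s (157)
# functional VERBATIM at `Dd := Dsel A′`; and: stationarity of `t ↦ 𝔄(expChart 1 (X_t − W_t))` + D″'s (157) `HasFDerivAt` ⇒ **`⟪δX, Δ_1X₁⟫ + Re φ(δ) = 0`** ((127) on the ♭ road, `T = 0`)

Cell `pub-ymgap`, width seat `pub-ymgap-k0-s1-w2` g6 (CLAIM-1, bus 2026-08-28 13:44Z; asked by dag-k0-s1-w1 g7 «the junction you can write against FILE 5» and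
dag-n07-w1 g6 «the assembler has no S4b letter left to ask except D″ itself»).  `--kind proof --supports stmt-QuantumFields-20541 --as helper`; count-neutral;
def-free.  [15] = [Balaban1985Variational]; [5] = [Balaban1985BackgroundPropagators]; [B6] = [Balaban1984PropagatorsII]; [B7] = [Balaban1985Averaging].

WHY.  On the ♭ road the (127)∕(128) junction reads: (a) dag-k0-s1-w1 g7 FILE 5 `…K0Stub1FlatChartCriticalityTransfer` — the Wilson action is STATIONARY at `t = 0`
along the charted curve `t ↦ e^{iη·Φ♭(A′₁ + tδ)}` (the record's criticality transported into the multi-level (0.4) fibre); (b) dag-n07-w1's (157) at NODE 00's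
STRAIGHT operators (p627407 `wilsonAction4_expChart_one_chart_eq157`: `𝔄(exp(X − W)) = ½⟪X, Δ_1X⟫ + (N·c²)⁻¹(½⟨Dd′, M Dd′⟩_F − ⟨Q X, M Dd′⟩_F) + Σ_p Re ρ_p`);
(c) this seat's Frobenius dictionary p636278 (the middle block IS `Re` of the Socket's two quadratic terms at instance (S): `Qlin♭ = λQ`, `M♭ = λ⁻¹Mλ⁻¹`, `Dd′ = iηλ⁻¹Dd`,
`c = η⁻¹`, `d = 4`); (d) dag-k0-s1-w4's `V₀` dictionary p635978 (`Re V₀ = Σ_p Re ρ_p`); (e) this seat's D″ p636369 — the (157) `HasFDerivAt` of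
`V_S(A) = ½B(Dsel A, η^dM♭ Dsel A) − B(Qlin♭A, η^dM♭ Dsel A) + V₀(A − H♭ Dsel A)` against `BE (W A′)`.  THIS FILE composes (b)(c)(d) into ONE identity whose
right-hand functional is (e)'s VERBATIM (§2), and turns «stationarity + (157) `HasFDerivAt`» into the ♭ (127) `⟪δX, Δ_1X₁⟫ + Re φ(δ) = 0` (§3) — the shape dag-n07-w1's
p624107 `socket_curlCurlExt_iff_socket_hessOpAt_inner` converts to dag-k0-s1-w1's `h128` currency with current `(N·c²)•Wf` and `T = 0`.

WHAT IS PROVED (sorry-free; no definition; axioms standard; generic `P` with `P.d = 4`, fibre `M_N(ℂ)`, `N ≥ 1`).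
* §1 dictionaries: `torusT_eq_shiftEquiv` (`rfl`), `dirForm_cfgGL_one`, `traceLinearMap_eq_of_ntr` (`τ = ntr ⇒ (N⁻¹•tr) = τ`), `coe_sub_apply`, `hermLetter_one_eq_of_coe`
  (`⇑X = iη•A′`, `⇑W = iη•Y ⇒ hermLetter η 1 (X − W) = (A′ − Y)♮`), `coe_expChart_one_eq_coe_expCfg` (`expChart 1 X = e^{iηA′}` bondwise), `kernelMap_pi_apply` (maps by `LinearMap.pi`).
* §2 ★★★ `wilsonAction4_expChart_eq157_flatScaled` — the displayed identity above, for EVERY herm0-valued `A′`, `Dd` (no chart needed: [15] (137) holds for every datum).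
* §3 ★★★ `inner_hessOpAt_add_re_eq_zero_of_stationary` — for herm0-valued `A′₁`, `δ`, tangent letters `⇑X₁ = iη•A′₁`, `⇑δX = iη•δ`, ANY map `Dsel` herm0-valued along the line
  near `0` (DISPLAYED reality letter), ANY tangent curve `Xc` with `⇑(Xc t) = iη•((A′₁ + tδ) − H♭Dsel(A′₁ + tδ))` near `0`, D″'s (157) `HasFDerivAt V_S φ A′₁` and STATIONARITY
  `HasDerivAt (t ↦ 𝔄(expChart 1 (Xc t))) 0 0`: **`⟪δX, Δ_1X₁⟫ + Re φ(δ) = 0`** (§2 pointwise near `0` ∘ dag-n07-w1 `hasDerivAt_inner_hessOpAt_line` ∘ p636278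
  `hasDerivAt_re_comp_realLine` ∘ uniqueness of derivatives).
HONEST SCOPE.  Algebra and first-order calculus over kernel-checked files cited BY NAME; NO estimate; the (157) `HasFDerivAt` (D″), the stationarity (dag-k0-s1-w1 FILE 5),
the reality of the implicit ♭ chart on Hermitian-traceless fields (dag-k0-s1-w4 p635684 `chartDFlat_valued_herm0`; to be DISPLAYED at D″'s `Dsel` by an edition of p631222 —
LOCATED-REALITY-THREAD, bus 13:44Z) and the kernel condition on `δ` are CONSUMED here, not produced; nothing of [15] Sects. D–F asserted; `stub_prop8StepCoP13` ∕ K0⁷ NOT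
closed; N07 NOT discharged; no summit statement is proved by this seat; counts unmoved (28∕28 · 5∕27); one finite 𝕋⁴ programme at fixed ε — R4 closes the conditional
finite-𝕋⁴ rung `BalabanLadder.UV` only, never the summit; the YM mass gap (Clay) is NOT proved by any of this; nothing continuum ∕ ℝ⁴ ∕ OS.  No `sorry`, no `def`, no
`instance`, no `notation`.

References: [15] (22) p.281, (26)–(27) p.282, (45)–(47) p.285, (80) p.290, (127)–(128) p.297, (137) p.298, (157) p.302; [5] (3.1) p.390, (3.10)–(3.12) p.392; [B6] (2.19)
p.226, (2.35) p.228; [B7] (17) p.21.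
-/

set_option autoImplicit false

noncomputable section

open scoped BigOperators Matrix InnerProductSpace RealInnerProductSpace Matrix.Norms.L2Operator Topology
open Filter

namespace Summit.QuantumFields.YangMills.Theorems.K0Stub1Eq157FlatScaledS1

open Literature.MathematicalPhysics.QuantumFieldTheory.Balaban1983to89
open Literature.MathematicalPhysics.QuantumFieldTheory.Balaban1983to89.Node00
open T4AdjointCovarianceUnitary (lieSU mem_lieSU_iff coe_expSU)
open B9AdOrthogonal (herm0 mem_herm0)
open B9Eq39Adjoint (bondPair rem3 posPlaq)
open B9TorusCalculus (torusT)
open B12Eq18Current (dirForm)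
open B6SectADomainsV1 (Domains)
open B6SectAOperatorsV1 (BondIdx QE QsE aE dcE dcsE)
open B6SectAVectorModelV1 (GE EE)
open B6SectA (hOp)
open B11Eq26ActionExpansion (V0)
open MatrixNorms (ntr)
open Summit.QuantumFields.YangMills.Theorems.K0FlatCubeOpsTextP (flatH)
open Summit.QuantumFields.YangMills.Theorems.Prop8ChartDoubleBar (chartLogFlat)
open Summit.QuantumFields.YangMills.Theorems.Prop8Chart (expCfg coe_expCfg)
open Summit.QuantumFields.YangMills.Theorems.K0Stub1FlatChartQlinLetters (fderiv_chartLogFlat_zero_kernel)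
open Summit.QuantumFields.YangMills.Theorems.K0Stub1FlatScaledFrobeniusDictionary (eq157_middle_terms_flatScaled hasDerivAt_re_comp_realLine)
open Summit.QuantumFields.YangMills.Theorems.K0Stub1V0Reality (re_V0_eq_sum_re_rem3)
open Summit.QuantumFields.YangMills.BalabanUVNodes.N07Eq157ActionInChartCoordinates (wilsonAction4_expChart_one_chart_eq157 cfgGL_one)
open Summit.QuantumFields.YangMills.BalabanUVNodes.N07SocketOfChartedCriticality (hasDerivAt_inner_hessOpAt_line)
open Summit.QuantumFields.YangMills.BalabanUVNodes.N07ChartLogReality (I_eta_smul_mem_lieSU)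

variable {P : Params} {N : ℕ}

/-! ## §1  Dictionaries -/

/-- pv27's torus datum of record IS the shift permutation family: `torusT P j = shiftEquiv`. [cite: Balaban1985BackgroundPropagators, (3.1) p.390 (bookkeeping)] -/
theorem torusT_eq_shiftEquiv (j : ℕ) : torusT P j = LatticeFieldCalculus.shiftEquiv (P := P) (j := j) := rfl

/-- At the flat background the direction form of the general-linear datum is the constant `1`. [cite: Balaban1985Variational, (26) p.282 (bookkeeping)] -/
theorem dirForm_cfgGL_one [NeZero N] (j : ℕ) :
    dirForm (cfgGL N (1 : GaugeField P j (SU N))) = fun _ _ => (1 : (Matrix (Fin N) (Fin N) ℂ)ˣ) := by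
  rw [cfgGL_one]; rfl

/-- `τ = ntr` (D″'s fibre letter) ⇒ S1's trace functional `N⁻¹•tr` IS `τ` as a linear map. [cite: Balaban1985Averaging, (17) p.21] -/
theorem traceLinearMap_eq_of_ntr [NeZero N] (τ : Matrix (Fin N) (Fin N) ℂ →L[ℂ] ℂ) (hntr : ∀ X, τ X = ntr X) :
    ((N : ℂ)⁻¹ • Matrix.traceLinearMap (Fin N) ℂ ℂ : Matrix (Fin N) (Fin N) ℂ →ₗ[ℂ] ℂ) = (τ : Matrix (Fin N) (Fin N) ℂ →ₗ[ℂ] ℂ) := by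
  refine LinearMap.ext fun X => ?_
  rw [ContinuousLinearMap.coe_coe, hntr, LinearMap.smul_apply, Matrix.traceLinearMap_apply, smul_eq_mul]
  unfold ntr
  rw [Fintype.card_fin, div_eq_inv_mul]

/-- `τ = ntr` ⇒ `N·τ X = tr X`. [cite: Balaban1985Averaging, (17) p.21] -/
theorem natCast_mul_of_ntr [NeZero N] (τ : Matrix (Fin N) (Fin N) ℂ →L[ℂ] ℂ) (hntr : ∀ X, τ X = ntr X) (X : Matrix (Fin N) (Fin N) ℂ) :
    (N : ℂ) * τ X = X.trace := by
  have hN : (N : ℂ) ≠ 0 := Nat.cast_ne_zero.mpr (NeZero.ne N)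
  rw [hntr]
  unfold ntr
  rw [Fintype.card_fin, mul_div_cancel₀ _ hN]

/-- components of a difference in the tangent carrier. [cite: Balaban1985Averaging, (17) p.21 (bookkeeping)] -/
theorem coe_sub_apply (X W : TangentBondSU P 0 N) (b : PBond P 0) :
    (((X - W) b : lieSU (Fin N)) : Matrix (Fin N) (Fin N) ℂ) = ((X b : lieSU (Fin N)) : Matrix (Fin N) (Fin N) ℂ) - ((W b : lieSU (Fin N)) : Matrix (Fin N) (Fin N) ℂ) := by
  rw [PiLp.sub_apply, Submodule.coe_sub]

/-- **PRINT's HERMITIAN LETTER OF `X − W` AT THE FLAT BACKGROUND**: if `⇑X = iη•A′` and `⇑W = iη•Y` bondwise then `hermLetter η 1 (X − W) = (μ, x) ↦ (A′ − Y)⟨x, μ⟩`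
(`(iη)⁻¹·1·(iηA′ − iηY)·1* = A′ − Y`). [cite: Balaban1985Variational, (22) p.281, (47) p.285] -/
theorem hermLetter_one_eq_of_coe [NeZero N] {η : ℝ} (hη : η ≠ 0) (X W : TangentBondSU P 0 N) (A' Y : PBond P 0 → Matrix (Fin N) (Fin N) ℂ)
    (hX : ∀ b, ((X b : lieSU (Fin N)) : Matrix (Fin N) (Fin N) ℂ) = (Complex.I * (η : ℂ)) • A' b)
    (hW : ∀ b, ((W b : lieSU (Fin N)) : Matrix (Fin N) (Fin N) ℂ) = (Complex.I * (η : ℂ)) • Y b) :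
    hermLetter η (1 : GaugeField P 0 (SU N)) (X - W) = fun μ x => (A' - Y) ⟨x, μ⟩ := by
  have hIη : (Complex.I * (η : ℂ)) ≠ 0 := mul_ne_zero Complex.I_ne_zero (Complex.ofReal_ne_zero.mpr hη)
  funext μ x
  have h1 : (((1 : GaugeField P 0 (SU N)) ⟨x, μ⟩ : SU N) : Matrix (Fin N) (Fin N) ℂ) = 1 := rfl
  unfold hermLetter
  rw [coe_sub_apply, hX, hW, h1, star_one, one_mul, mul_one, ← smul_sub, smul_smul, inv_mul_cancel₀ hIη, one_smul, Pi.sub_apply]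

/-- **S1's EXPONENTIAL CHART AT `1` IS THE CHARTED CONFIGURATION `e^{iηA′}`**: `⇑X = iη•A′` bondwise ⇒ `↑(expChart 1 X b) = ↑(expCfg η A′ b)`.
[cite: Balaban1985Variational, (22) p.281, (152) p.301] -/
theorem coe_expChart_one_eq_coe_expCfg [NeZero N] (η : ℝ) (X : PBond P 0 → lieSU (Fin N)) (A' : PBond P 0 → Matrix (Fin N) (Fin N) ℂ)
    (hX : ∀ b, ((X b : lieSU (Fin N)) : Matrix (Fin N) (Fin N) ℂ) = (Complex.I * (η : ℂ)) • A' b) (b : PBond P 0) :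
    ((expChart (1 : GaugeField P 0 (SU N)) X b : SU N) : Matrix (Fin N) (Fin N) ℂ) = ((expCfg η A' b : (Matrix (Fin N) (Fin N) ℂ)ˣ) : Matrix (Fin N) (Fin N) ℂ) := by
  have h1 : (((1 : GaugeField P 0 (SU N)) b : SU N) : Matrix (Fin N) (Fin N) ℂ) = 1 := rfl
  rw [coe_expChart, coe_expCfg, h1, one_mul, hX]

/-- components of a map defined by `LinearMap.pi` of kernel rows. [folklore] -/
theorem kernelMap_pi_apply {ι κ : Type*} [Fintype ι] (ker : κ → ι → ℝ) (X : ι → Matrix (Fin N) (Fin N) ℂ) (t : κ) :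
    (LinearMap.pi fun t => ∑ s, ((ker t s : ℝ) : ℂ) • (LinearMap.proj s : (ι → Matrix (Fin N) (Fin N) ℂ) →ₗ[ℂ] Matrix (Fin N) (Fin N) ℂ)) X t =
      ∑ s, ((ker t s : ℝ) : ℂ) • X s := by
  simp only [LinearMap.pi_apply, LinearMap.coe_sum, Finset.sum_apply, LinearMap.smul_apply, LinearMap.coe_proj, Function.eval]

/-- `iηr•X ∈ 𝔰𝔲(N)` for Hermitian-traceless `X` and real `η, r`. [cite: Balaban1985Averaging, (17) p.21 (bookkeeping)] -/
theorem I_mul_mul_smul_mem_lieSU (η r : ℝ) {X : Matrix (Fin N) (Fin N) ℂ} (hX : X ∈ herm0 (Fin N)) :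
    (Complex.I * (η : ℂ) * (r : ℂ)) • X ∈ lieSU (Fin N) := by
  rw [mul_assoc, ← Complex.ofReal_mul]
  exact I_eta_smul_mem_lieSU (η * r) hX

/-! ## §2  (157) at instance (S) in S1's currency -/

section Eq157

variable [NeZero N] (D : Domains P) (k : ℕ)

/-- ★★★ **[15] (157) AT INSTANCE (S) IN S1's CURRENCY.**  For a nested family `D` at height `k` (`η = L^{−k}`), the fibre letter `τ = ntr`, the block pairing
`B = Σ_t τ`, the SCALED multiplier `M♭` (kernel `λ_t⁻¹·(E − a)(t,s)·λ_s⁻¹`, `λ_t = L^{j(t)}η`) and the ♭ right inverse `H♭` (kernel `λ_t⁻¹·(flatH e_t)(b)`) — D″'s DISPLAYED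
kernel formulas VERBATIM — every Hermitian-traceless fine field `A′` and block datum `Dd`, and tangent letters `X, W ∈ TangentBondSU P 0 N` with `⇑X = iη•A′`, `⇑W = iη•H♭Dd`:
**`𝔄(expChart 1 (X − W)) = ½⟪X, Δ_1X⟫ + Re(½B(Dd, η^d•M♭Dd) − B(Qlin♭A′, η^d•M♭Dd) + V₀[shiftEquiv, 1](A′ − H♭Dd))`**, `Qlin♭ = D(chartLogFlat η D)(0)`, `d = 4` — p627407 §5 at
the 𝔰𝔲(N) datum `Dd′ = iηλ⁻¹Dd` and `c = η⁻¹ = L^k` ∘ p636278 `eq157_middle_terms_flatScaled` ∘ p635978 `re_V0_eq_sum_re_rem3` ∘ §1.  No chart is needed ((137) holds for every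
datum); at `Dd := Dsel♭ A′` the functional inside `Re` is D″'s (157) functional `V_S(A′)`.
[cite: Balaban1985Variational, (157) p.302, (80) p.290, (47) p.285, (26)-(27) p.282, (137) p.298; Balaban1985BackgroundPropagators, (3.10)-(3.12) p.392; Balaban1984PropagatorsII, (2.19) p.226, (2.35) p.228] -/
theorem wilsonAction4_expChart_eq157_flatScaled (hd : P.d = 4) (hc : (P.L : ℝ) ^ k ≠ 0) (hwa : ∀ _i : BondIdx D, (0 : ℝ) < 1)
    (τ : Matrix (Fin N) (Fin N) ℂ →L[ℂ] ℂ) (hntr : ∀ X, τ X = ntr X)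
    (B : (BondIdx D → Matrix (Fin N) (Fin N) ℂ) →L[ℂ] (BondIdx D → Matrix (Fin N) (Fin N) ℂ) →L[ℂ] ℂ)
    (hB : ∀ X X' : BondIdx D → Matrix (Fin N) (Fin N) ℂ, B X X' = ∑ t, τ (X t * X' t))
    (MV : (BondIdx D → Matrix (Fin N) (Fin N) ℂ) →L[ℂ] (BondIdx D → Matrix (Fin N) (Fin N) ℂ))
    (hMV : ∀ (X : BondIdx D → Matrix (Fin N) (Fin N) ℂ) (t : BondIdx D),
      MV X t = ∑ s, ((((P.L : ℝ) ^ (t.1.1 : ℕ) * (((P.L : ℝ))⁻¹) ^ k)⁻¹ *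
        WithLp.ofLp ((EE D hc hwa - aE D (fun _ => (1 : ℝ))) (WithLp.toLp 2 (Pi.single s 1))) t *
        ((P.L : ℝ) ^ (s.1.1 : ℕ) * (((P.L : ℝ))⁻¹) ^ k)⁻¹ : ℝ) : ℂ) • X s)
    (H : (BondIdx D → Matrix (Fin N) (Fin N) ℂ) →ₗ[ℂ] (PBond P 0 → Matrix (Fin N) (Fin N) ℂ))
    (hH : ∀ (X : BondIdx D → Matrix (Fin N) (Fin N) ℂ) (b : PBond P 0), H X b =
      ∑ t, ((((P.L : ℝ) ^ (t.1.1 : ℕ) * (((P.L : ℝ))⁻¹) ^ k)⁻¹ * flatH P k D (Pi.single t 1) b : ℝ) : ℂ) • X t)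
    (A' : PBond P 0 → Matrix (Fin N) (Fin N) ℂ) (hA' : ∀ b, A' b ∈ herm0 (Fin N))
    (Dd : BondIdx D → Matrix (Fin N) (Fin N) ℂ) (hDd : ∀ t, Dd t ∈ herm0 (Fin N))
    (X W : TangentBondSU P 0 N)
    (hX : ∀ b, ((X b : lieSU (Fin N)) : Matrix (Fin N) (Fin N) ℂ) = (Complex.I * ((((P.L : ℝ)⁻¹) ^ k : ℝ) : ℂ)) • A' b)
    (hW : ∀ b, ((W b : lieSU (Fin N)) : Matrix (Fin N) (Fin N) ℂ) = (Complex.I * ((((P.L : ℝ)⁻¹) ^ k : ℝ) : ℂ)) • H Dd b) :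
    wilsonAction4 (expChart (1 : GaugeField P 0 (SU N)) (WithLp.ofLp (X - W))) =
      2⁻¹ * ⟪X, hessOpAt (((P.L : ℝ)⁻¹) ^ k) (1 : GaugeField P 0 (SU N)) X⟫_ℝ
        + (2⁻¹ * B Dd ((((((((P.L : ℝ))⁻¹) ^ k : ℝ) : ℂ) ^ P.d) • MV) Dd)
            - B ((fderiv ℂ (chartLogFlat ((((P.L : ℝ))⁻¹) ^ k) D :
                (PBond P 0 → Matrix (Fin N) (Fin N) ℂ) → BondIdx D → Matrix (Fin N) (Fin N) ℂ) 0) A')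
                ((((((((P.L : ℝ))⁻¹) ^ k : ℝ) : ℂ) ^ P.d) • MV) Dd)
            + V0 (LatticeFieldCalculus.shiftEquiv (P := P) (j := 0)) (fun _ _ => (1 : (Matrix (Fin N) (Fin N) ℂ)ˣ)) (((P.L : ℝ)⁻¹) ^ k) P.d
                (τ : Matrix (Fin N) (Fin N) ℂ →ₗ[ℂ] ℂ) (fun μ x => (A' - H Dd) ⟨x, μ⟩)).re := by
  -- letters
  set η : ℝ := ((P.L : ℝ)⁻¹) ^ k with hηdef
  have hL0 : (0 : ℝ) < P.L := by exact_mod_cast P.L_pos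
  have hη0 : η ≠ 0 := by rw [hηdef]; positivity
  have hηc : (P.L : ℝ) ^ k = η⁻¹ := by rw [hηdef, inv_pow, inv_inv]
  have hN : N ≠ 0 := NeZero.ne N
  have hd4 : 4 ≤ P.d := hd ▸ le_rfl
  -- the four kernel-read maps of p627407 (straight letters), by `LinearMap.pi`
  let kK : PBond P 0 → PBond P 0 → ℝ := fun b j => WithLp.ofLp ((dcsE ((P.L : ℝ) ^ k) ∘ₗ dcE ((P.L : ℝ) ^ k)) (WithLp.toLp 2 (Pi.single j 1))) b
  let q : BondIdx D → PBond P 0 → ℝ := fun t b => WithLp.ofLp (QE D (WithLp.toLp 2 (Pi.single b 1))) t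
  let hVk : PBond P 0 → BondIdx D → ℝ := fun b t => WithLp.ofLp (hOp (GE D hc hwa) (QsE D) (EE D hc hwa) (WithLp.toLp 2 (Pi.single t 1))) b
  let m : BondIdx D → BondIdx D → ℝ := fun t s => WithLp.ofLp ((EE D hc hwa - aE D (fun _ => (1 : ℝ))) (WithLp.toLp 2 (Pi.single s 1))) t
  let lam : BondIdx D → ℝ := fun t => (P.L : ℝ) ^ (t.1.1 : ℕ) * η
  have hlam : ∀ t, lam t ≠ 0 := fun t => by positivity
  let KV : (PBond P 0 → Matrix (Fin N) (Fin N) ℂ) →ₗ[ℂ] (PBond P 0 → Matrix (Fin N) (Fin N) ℂ) :=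
    LinearMap.pi fun b => ∑ j, ((kK b j : ℝ) : ℂ) • (LinearMap.proj j : (PBond P 0 → Matrix (Fin N) (Fin N) ℂ) →ₗ[ℂ] Matrix (Fin N) (Fin N) ℂ)
  let QV : (PBond P 0 → Matrix (Fin N) (Fin N) ℂ) →ₗ[ℂ] (BondIdx D → Matrix (Fin N) (Fin N) ℂ) :=
    LinearMap.pi fun t => ∑ b, ((q t b : ℝ) : ℂ) • (LinearMap.proj b : (PBond P 0 → Matrix (Fin N) (Fin N) ℂ) →ₗ[ℂ] Matrix (Fin N) (Fin N) ℂ)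
  let HV : (BondIdx D → Matrix (Fin N) (Fin N) ℂ) →ₗ[ℂ] (PBond P 0 → Matrix (Fin N) (Fin N) ℂ) :=
    LinearMap.pi fun b => ∑ t, ((hVk b t : ℝ) : ℂ) • (LinearMap.proj t : (BondIdx D → Matrix (Fin N) (Fin N) ℂ) →ₗ[ℂ] Matrix (Fin N) (Fin N) ℂ)
  let MVu : (BondIdx D → Matrix (Fin N) (Fin N) ℂ) →ₗ[ℂ] (BondIdx D → Matrix (Fin N) (Fin N) ℂ) :=
    LinearMap.pi fun t => ∑ s, ((m t s : ℝ) : ℂ) • (LinearMap.proj s : (BondIdx D → Matrix (Fin N) (Fin N) ℂ) →ₗ[ℂ] Matrix (Fin N) (Fin N) ℂ)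
  have hKV : ∀ (A : PBond P 0 → Matrix (Fin N) (Fin N) ℂ) (b : PBond P 0),
      KV A b = ∑ j, ((WithLp.ofLp ((dcsE ((P.L : ℝ) ^ k) ∘ₗ dcE ((P.L : ℝ) ^ k)) (WithLp.toLp 2 (Pi.single j 1))) b : ℝ) : ℂ) • A j :=
    fun A b => kernelMap_pi_apply kK A b
  have hQV : ∀ (A : PBond P 0 → Matrix (Fin N) (Fin N) ℂ) (t : BondIdx D),
      QV A t = ∑ b, ((WithLp.ofLp (QE D (WithLp.toLp 2 (Pi.single b 1))) t : ℝ) : ℂ) • A b :=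
    fun A t => kernelMap_pi_apply q A t
  have hHV : ∀ (Y : BondIdx D → Matrix (Fin N) (Fin N) ℂ) (b : PBond P 0),
      HV Y b = ∑ t, ((WithLp.ofLp (hOp (GE D hc hwa) (QsE D) (EE D hc hwa) (WithLp.toLp 2 (Pi.single t 1))) b : ℝ) : ℂ) • Y t :=
    fun Y b => kernelMap_pi_apply hVk Y b
  have hMVu : ∀ (Y : BondIdx D → Matrix (Fin N) (Fin N) ℂ) (t : BondIdx D),
      MVu Y t = ∑ s, ((WithLp.ofLp ((EE D hc hwa - aE D (fun _ => (1 : ℝ))) (WithLp.toLp 2 (Pi.single s 1))) t : ℝ) : ℂ) • Y s :=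
    fun Y t => kernelMap_pi_apply m Y t
  -- the 𝔰𝔲(N) datum `Dd′ = iηλ⁻¹•Dd` of p627407 and `⇑W = H_V ⇑Dd′`
  let Dd' : BondIdx D → lieSU (Fin N) := fun t =>
    ⟨(Complex.I * (η : ℂ) * (((lam t)⁻¹ : ℝ) : ℂ)) • Dd t, I_mul_mul_smul_mem_lieSU η (lam t)⁻¹ (hDd t)⟩
  have hDd' : ∀ t, ((Dd' t : lieSU (Fin N)) : Matrix (Fin N) (Fin N) ℂ) = (Complex.I * (η : ℂ) * (((lam t)⁻¹ : ℝ) : ℂ)) • Dd t := fun _ => rfl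
  have hflat : ∀ (b : PBond P 0) (t : BondIdx D), hVk b t = flatH P k D (Pi.single t 1) b := fun _ _ => rfl
  have hW' : ∀ b, ((W b : lieSU (Fin N)) : Matrix (Fin N) (Fin N) ℂ) = HV (fun t => ((Dd' t : lieSU (Fin N)) : Matrix (Fin N) (Fin N) ℂ)) b := by
    intro b
    rw [hW b, hH, kernelMap_pi_apply, Finset.smul_sum]
    refine Finset.sum_congr rfl fun t _ => ?_
    rw [hDd', smul_smul, smul_smul, hflat]
    congr 1
    dsimp only [lam]
    push_cast
    ring
  -- (157) at the straight letters (p627407 §5)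
  have h157 := wilsonAction4_expChart_one_chart_eq157 D hc hwa (w := fun _ => (1 : ℝ)) hη0 hKV hQV hHV hMVu X W Dd' hW'
  rw [h157]
  -- the middle block: p636278 at `c = η⁻¹`
  have hXf : (fun b => ((X b : lieSU (Fin N)) : Matrix (Fin N) (Fin N) ℂ)) = fun b => (Complex.I * (η : ℂ)) • A' b := funext hX
  have hDdf : (fun t => ((Dd' t : lieSU (Fin N)) : Matrix (Fin N) (Fin N) ℂ)) = fun s => (Complex.I * (η : ℂ) * (((lam s)⁻¹ : ℝ) : ℂ)) • Dd s :=
    funext hDd'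
  have hτN : ∀ Y : Matrix (Fin N) (Fin N) ℂ, (N : ℂ) * (τ : Matrix (Fin N) (Fin N) ℂ →ₗ[ℂ] ℂ) Y = Y.trace := fun Y => by
    rw [ContinuousLinearMap.coe_coe]; exact natCast_mul_of_ntr τ hntr Y
  have hmid := eq157_middle_terms_flatScaled hη0 hN lam hlam m q (fun Y => MVu Y) (fun Y => MV Y) hMVu hMV (fun A => QV A)
    (fun A => fderiv ℂ (chartLogFlat η D : (PBond P 0 → Matrix (Fin N) (Fin N) ℂ) → BondIdx D → Matrix (Fin N) (Fin N) ℂ) 0 A) hQV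
    (fun A t => fderiv_chartLogFlat_zero_kernel η D A t) (τ : Matrix (Fin N) (Fin N) ℂ →ₗ[ℂ] ℂ) hτN (fun Y Z => B Y Z) hB
    A' (fun b => ((mem_herm0).1 (hA' b)).1.eq) Dd (fun t => ((mem_herm0).1 (hDd t)).1.eq)
  -- the `V₀` block: p635978 at the flat background, `d = 4`
  have hτtr : ∀ a b : Matrix (Fin N) (Fin N) ℂ, (τ : Matrix (Fin N) (Fin N) ℂ →ₗ[ℂ] ℂ) (a * b) = (τ : Matrix (Fin N) (Fin N) ℂ →ₗ[ℂ] ℂ) (b * a) :=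
    fun a b => by
      rw [ContinuousLinearMap.coe_coe, hntr, hntr]
      unfold ntr
      rw [Matrix.trace_mul_comm]
  have hV0 := re_V0_eq_sum_re_rem3 (LatticeFieldCalculus.shiftEquiv (P := P) (j := 0)) (fun _ _ => (1 : (Matrix (Fin N) (Fin N) ℂ)ˣ))
    (τ : Matrix (Fin N) (Fin N) ℂ →ₗ[ℂ] ℂ) hτtr η hη0 hd4 (fun μ x => (A' - H Dd) ⟨x, μ⟩)
  rw [show P.d - 4 = 0 by omega, pow_zero, one_mul, ← Complex.re_sum] at hV0
  -- assemble
  have hsm : ∀ (c' : ℂ) (Z : BondIdx D → Matrix (Fin N) (Fin N) ℂ), (c' • MV) Z = c' • MV Z := fun _ _ => rfl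
  have hpow : (((η : ℝ) : ℂ) ^ P.d) = ((η : ℝ) : ℂ) ^ 4 := by rw [hd]
  rw [torusT_eq_shiftEquiv, dirForm_cfgGL_one, traceLinearMap_eq_of_ntr τ hntr, hermLetter_one_eq_of_coe hη0 X W A' (H Dd) hX hW, hXf, hDdf,
    show ((N : ℝ) * ((P.L : ℝ) ^ k) ^ 2)⁻¹ = ((N : ℝ) * (η⁻¹) ^ 2)⁻¹ by rw [hηc], hmid, hsm, hpow, Complex.add_re, hV0, add_assoc]

end Eq157

/-! ## §3  The ♭ (127) from stationarity: `⟪δX, Δ_1X₁⟫ + Re φ(δ) = 0` -/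

section Socket

variable [NeZero N] (D : Domains P) (k : ℕ)

/-- ★★★ **THE ♭ (127) FROM STATIONARITY AND THE (157) CERTIFICATE.**  Same letters as §2; a map `Dsel` (the implicit ♭ chart of record), Hermitian-traceless `A′₁`
(base point) and `δ` (direction) with tangent letters `⇑X₁ = iη•A′₁`, `⇑δX = iη•δ`; the DISPLAYED reality letter «`Dsel(A′₁ + tδ)` is Hermitian-traceless for `t` near
`0`»; ANY tangent curve `Xc` with `⇑(Xc t) = iη•((A′₁ + tδ) − H♭·Dsel(A′₁ + tδ))` for `t` near `0` (the charted curve `Φ♭(A′₁ + tδ)` in S1's carrier); D″'s (157)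
certificate `HasFDerivAt V_S φ A′₁` (`V_S` = D″'s functional VERBATIM, `φ = BE (W A′₁)` there); and STATIONARITY `HasDerivAt (t ↦ 𝔄(expChart 1 (Xc t))) 0 0`
(dag-k0-s1-w1 FILE 5's output) ⟹ **`⟪δX, Δ_1X₁⟫ + Re φ(δ) = 0`** — [15] (127) on the ♭ road with `T = 0`, in the currency of p624107
`socket_curlCurlExt_iff_socket_hessOpAt_inner` (§2 pointwise near `0`; dag-n07-w1 `hasDerivAt_inner_hessOpAt_line`; p636278 `hasDerivAt_re_comp_realLine`; uniqueness
of derivatives). [cite: Balaban1985Variational, (127)-(128) p.297, (157) p.302, (47) p.285, (80) p.290; Balaban1985BackgroundPropagators, (3.10) p.392] -/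
theorem inner_hessOpAt_add_re_eq_zero_of_stationary (hd : P.d = 4) (hc : (P.L : ℝ) ^ k ≠ 0) (hwa : ∀ _i : BondIdx D, (0 : ℝ) < 1)
    (τ : Matrix (Fin N) (Fin N) ℂ →L[ℂ] ℂ) (hntr : ∀ X, τ X = ntr X)
    (B : (BondIdx D → Matrix (Fin N) (Fin N) ℂ) →L[ℂ] (BondIdx D → Matrix (Fin N) (Fin N) ℂ) →L[ℂ] ℂ)
    (hB : ∀ X X' : BondIdx D → Matrix (Fin N) (Fin N) ℂ, B X X' = ∑ t, τ (X t * X' t))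
    (MV : (BondIdx D → Matrix (Fin N) (Fin N) ℂ) →L[ℂ] (BondIdx D → Matrix (Fin N) (Fin N) ℂ))
    (hMV : ∀ (X : BondIdx D → Matrix (Fin N) (Fin N) ℂ) (t : BondIdx D),
      MV X t = ∑ s, ((((P.L : ℝ) ^ (t.1.1 : ℕ) * (((P.L : ℝ))⁻¹) ^ k)⁻¹ *
        WithLp.ofLp ((EE D hc hwa - aE D (fun _ => (1 : ℝ))) (WithLp.toLp 2 (Pi.single s 1))) t *
        ((P.L : ℝ) ^ (s.1.1 : ℕ) * (((P.L : ℝ))⁻¹) ^ k)⁻¹ : ℝ) : ℂ) • X s)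
    (H : (BondIdx D → Matrix (Fin N) (Fin N) ℂ) →ₗ[ℂ] (PBond P 0 → Matrix (Fin N) (Fin N) ℂ))
    (hH : ∀ (X : BondIdx D → Matrix (Fin N) (Fin N) ℂ) (b : PBond P 0), H X b =
      ∑ t, ((((P.L : ℝ) ^ (t.1.1 : ℕ) * (((P.L : ℝ))⁻¹) ^ k)⁻¹ * flatH P k D (Pi.single t 1) b : ℝ) : ℂ) • X t)
    (Dsel : (PBond P 0 → Matrix (Fin N) (Fin N) ℂ) → (BondIdx D → Matrix (Fin N) (Fin N) ℂ))
    (A₁ δ : PBond P 0 → Matrix (Fin N) (Fin N) ℂ) (hA₁ : ∀ b, A₁ b ∈ herm0 (Fin N)) (hδ : ∀ b, δ b ∈ herm0 (Fin N))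
    (hDh : ∀ᶠ t : ℝ in 𝓝 0, ∀ i, Dsel (A₁ + (t : ℂ) • δ) i ∈ herm0 (Fin N))
    (X₁ δX : TangentBondSU P 0 N)
    (hX₁ : ∀ b, ((X₁ b : lieSU (Fin N)) : Matrix (Fin N) (Fin N) ℂ) = (Complex.I * ((((P.L : ℝ)⁻¹) ^ k : ℝ) : ℂ)) • A₁ b)
    (hδX : ∀ b, ((δX b : lieSU (Fin N)) : Matrix (Fin N) (Fin N) ℂ) = (Complex.I * ((((P.L : ℝ)⁻¹) ^ k : ℝ) : ℂ)) • δ b)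
    (Xc : ℝ → TangentBondSU P 0 N)
    (hXc : ∀ᶠ t : ℝ in 𝓝 0, ∀ b, ((Xc t b : lieSU (Fin N)) : Matrix (Fin N) (Fin N) ℂ) =
      (Complex.I * ((((P.L : ℝ)⁻¹) ^ k : ℝ) : ℂ)) • ((A₁ + (t : ℂ) • δ) b - H (Dsel (A₁ + (t : ℂ) • δ)) b))
    {φ : (PBond P 0 → Matrix (Fin N) (Fin N) ℂ) →L[ℂ] ℂ}
    (h157 : HasFDerivAt (fun A : PBond P 0 → Matrix (Fin N) (Fin N) ℂ =>
        2⁻¹ * B (Dsel A) ((((((((P.L : ℝ))⁻¹) ^ k : ℝ) : ℂ) ^ P.d) • MV) (Dsel A))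
          - B ((fderiv ℂ (chartLogFlat ((((P.L : ℝ))⁻¹) ^ k) D :
              (PBond P 0 → Matrix (Fin N) (Fin N) ℂ) → BondIdx D → Matrix (Fin N) (Fin N) ℂ) 0) A)
              ((((((((P.L : ℝ))⁻¹) ^ k : ℝ) : ℂ) ^ P.d) • MV) (Dsel A))
          + V0 (LatticeFieldCalculus.shiftEquiv (P := P) (j := 0)) (fun _ _ => (1 : (Matrix (Fin N) (Fin N) ℂ)ˣ)) (((P.L : ℝ)⁻¹) ^ k) P.d
              (τ : Matrix (Fin N) (Fin N) ℂ →ₗ[ℂ] ℂ) (fun μ x => (A - H (Dsel A)) ⟨x, μ⟩)) φ A₁)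
    (hstat : HasDerivAt (fun t : ℝ => wilsonAction4 (expChart (1 : GaugeField P 0 (SU N)) (WithLp.ofLp (Xc t)))) 0 0) :
    ⟪δX, hessOpAt (((P.L : ℝ)⁻¹) ^ k) (1 : GaugeField P 0 (SU N)) X₁⟫_ℝ + (φ δ).re = 0 := by
  set η : ℝ := ((P.L : ℝ)⁻¹) ^ k with hηdef
  -- D″'s functional
  set VS : (PBond P 0 → Matrix (Fin N) (Fin N) ℂ) → ℂ := fun A =>
    2⁻¹ * B (Dsel A) (((((η : ℝ) : ℂ) ^ P.d) • MV) (Dsel A))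
      - B ((fderiv ℂ (chartLogFlat η D : (PBond P 0 → Matrix (Fin N) (Fin N) ℂ) → BondIdx D → Matrix (Fin N) (Fin N) ℂ) 0) A)
          (((((η : ℝ) : ℂ) ^ P.d) • MV) (Dsel A))
      + V0 (LatticeFieldCalculus.shiftEquiv (P := P) (j := 0)) (fun _ _ => (1 : (Matrix (Fin N) (Fin N) ℂ)ˣ)) η P.d
          (τ : Matrix (Fin N) (Fin N) ℂ →ₗ[ℂ] ℂ) (fun μ x => (A - H (Dsel A)) ⟨x, μ⟩) with hVS
  -- (v): the derivative of `Re V_S` along the real line (p636278 §2)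
  have hV : HasDerivAt (fun t : ℝ => (VS (A₁ + (t : ℂ) • δ)).re) (φ δ).re 0 := hasDerivAt_re_comp_realLine VS h157 δ
  -- the quadratic part (dag-n07-w1 §1)
  have hq := hasDerivAt_inner_hessOpAt_line η (1 : GaugeField P 0 (SU N)) X₁ δX
  -- the (157) split of the action along the curve, near `0` (§2 pointwise)
  have hsplit : ∀ᶠ t : ℝ in 𝓝 0, wilsonAction4 (expChart (1 : GaugeField P 0 (SU N)) (WithLp.ofLp (Xc t))) =
      2⁻¹ * ⟪X₁ + t • δX, hessOpAt η (1 : GaugeField P 0 (SU N)) (X₁ + t • δX)⟫_ℝ + (VS (A₁ + (t : ℂ) • δ)).re := by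
    filter_upwards [hDh, hXc] with t hDt hXt
    have hA' : ∀ b, (A₁ + (t : ℂ) • δ) b ∈ herm0 (Fin N) := fun b => by
      rw [Pi.add_apply, Pi.smul_apply, Complex.coe_smul]
      exact Submodule.add_mem _ (hA₁ b) (Submodule.smul_mem _ t (hδ b))
    have hXt' : ∀ b, (((X₁ + t • δX) b : lieSU (Fin N)) : Matrix (Fin N) (Fin N) ℂ) = (Complex.I * (η : ℂ)) • (A₁ + (t : ℂ) • δ) b := by
      intro b
      rw [PiLp.add_apply, PiLp.smul_apply, Submodule.coe_add, Submodule.coe_smul, hX₁, hδX, Pi.add_apply, Pi.smul_apply, smul_add,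
        ← Complex.coe_smul, smul_comm]
    have hWt : ∀ b, ((((X₁ + t • δX) - Xc t) b : lieSU (Fin N)) : Matrix (Fin N) (Fin N) ℂ) =
        (Complex.I * (η : ℂ)) • H (Dsel (A₁ + (t : ℂ) • δ)) b := by
      intro b
      rw [coe_sub_apply, hXt', hXt b, ← smul_sub, sub_sub_cancel]
    have key := wilsonAction4_expChart_eq157_flatScaled D k hd hc hwa τ hntr B hB MV hMV H hH (A₁ + (t : ℂ) • δ) hA' (Dsel (A₁ + (t : ℂ) • δ)) hDt
      (X₁ + t • δX) ((X₁ + t • δX) - Xc t) hXt' hWt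
    rwa [sub_sub_cancel] at key
  -- the derivative of the action along the curve, computed through the split, is `⟪δX, Δ_1X₁⟫ + Re φ(δ)`; it is `0` by stationarity
  have hsum : HasDerivAt (fun t : ℝ => wilsonAction4 (expChart (1 : GaugeField P 0 (SU N)) (WithLp.ofLp (Xc t))))
      (⟪δX, hessOpAt η (1 : GaugeField P 0 (SU N)) X₁⟫_ℝ + (φ δ).re) 0 :=
    (hq.add hV).congr_of_eventuallyEq hsplit
  exact hsum.unique hstat

end Socket

end Summit.QuantumFields.YangMills.Theorems.K0Stub1Eq157FlatScaledS1

end
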